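import Literature.NumberTheory.GaloisRepresentations.ContinuousRepCoeffExtension
import Literature.NumberTheory.EllipticCurves.GreenbergSelmerNewform
import Mathlib.NumberTheory.Padics.PadicIntegers
import HarnessLib

/-!
# Torsion-level algebra for «`E[p] ↪ ρ̄_{g_m}`»: pure tensors in `𝒪 ⊗_R A`, the reduction map `A[ϖ] → (𝒪/ϖ)ⁿ` of a
# framed representation, and transport along a torsion-level equivariant isomorphism (helper,
# `--supports stmt-BirchSwinnertonDyer-23253`)

Cell `bsd-stepL`, seat `bsd-stepL-imc-p1` (prover g27, 2026-08-28). Theorems only (no definition, no named fact, no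
`sorry`, no instance, no notation). Part 2a (pure algebra) of the bridge «`Surj W p` ⟹ `ρ̄_{g_m}|_{G_K}` irreducible»
(part 1: `ErratumRoadFiveTransvectionIrreducibility.lean`; part 2b, the arithmetic instance for a Hida member:
`ErratumRoadFiveResidualRepOfMemberTorsion.lean`; part 3: `ErratumRoadFiveSurjIrrK.lean`). Everything here is generic
module algebra; the member file instantiates it with `𝒪 = 𝒪_m`, `X = A_{g_m} = K²/𝒪²`, `N = E[p^∞] ⊗_{ℤ_p} 𝒪_m`,
`e = D.e`, `V = (𝒪_m/ϖ)²`.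

* §1 pure-tensor bookkeeping in `𝒪 ⊗_R A` (`smul_tmul_eq`, `tmul_smul_eq`, `tmul_add_eq`, `tmul_zero_eq`,
  `smul_eq_zero_of_tmul_eq_zero`) and `exists_eq_mul_of_tmul_eq_zero` — with `𝒪` free over `ℤ_p`: if `c ⊗ a = 0` and
  the annihilator of `a` lies in `(p)`, then `c ∈ p𝒪` (coordinates in a `ℤ_p`-basis).
* §2 `exists_torsion_reduction_hom` — for any framed `ρ : G → GL_n(𝒪)`, `𝒪 ⊆ F`, `ϖ ≠ 0`: an injective additive
  `Θ₀ : A[ϖ] → (𝒪/ϖ)ⁿ`, `x mod 𝒪ⁿ ↦ (ϖ x) mod ϖ`, intertwining the action on `A = Fⁿ/𝒪ⁿ` and `ρ̄ = ρ mod ϖ`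
  (`A[ϖ] ≅ T/ϖT` as `G`-modules; EPW §3.1).
* §3 `exists_transport_torsion_hom`, `exists_equivariant_hom_of_transport` — transport of an injective equivariant
  `β : E → N[r]` killed by `ϖ` along an equivariant `e : X[r] ≃ N[r]` to `E → X[ϖ]`, then composition with `Θ₀`.

HONEST FRAMING: module algebra; nothing about `L`-functions or BSD for any pair; closes: none (T7).

## References
* [EmertonPollackWeston2006] §3.1 (p. 17: `T̄_f = T_f/π`, `A_f = K/𝒪 ⊗ T_f`).
* [Skinner2016PacificMC] §2.6 (2-6-1), §3.1 (b) (p. 192) (the torsion-level isomorphism transported along).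
-/

noncomputable section

open scoped TensorProduct

set_option autoImplicit false
-- D-0017: single-problem summit, the namespace repeats the problem name by design.
set_option linter.dupNamespace false

namespace Summit.BirchSwinnertonDyer.BirchSwinnertonDyer.Theorems.SurjIrrK

open Literature.NumberTheory.GaloisRepresentations Literature.NumberTheory.EllipticCurves.GreenbergSelmer

/-! ## §1 Pure tensors `c ⊗ a` in `𝒪 ⊗_R A` for `𝒪` free over `R` -/

section Tensor

variable {R : Type*} [CommRing R] {𝒪 : Type*} [CommRing 𝒪] [Algebra R 𝒪]
  {A : Type*} [AddCommGroup A] [Module R A]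

/-- `c' • (c ⊗ a) = (c' c) ⊗ a` in `𝒪 ⊗_R A` (the `𝒪`-module structure is on the left factor). [folklore] -/
theorem smul_tmul_eq (c' c : 𝒪) (a : A) :
    c' • (CoeffExtension.tmul c a : CoeffExtension R 𝒪 A) = CoeffExtension.tmul (c' * c) a := by
  change c' • (c ⊗ₜ[R] a : 𝒪 ⊗[R] A) = (c' * c) ⊗ₜ[R] a
  rw [TensorProduct.smul_tmul', smul_eq_mul]

/-- `c ⊗ (r • a) = (r • c) ⊗ a` in `𝒪 ⊗_R A` for `r ∈ R`. [folklore] -/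
theorem tmul_smul_eq (r : R) (c : 𝒪) (a : A) :
    (CoeffExtension.tmul c (r • a) : CoeffExtension R 𝒪 A) = CoeffExtension.tmul (r • c) a := by
  change (c ⊗ₜ[R] (r • a) : 𝒪 ⊗[R] A) = (r • c) ⊗ₜ[R] a
  rw [TensorProduct.smul_tmul]

/-- `c ⊗ (a + b) = c ⊗ a + c ⊗ b` in `𝒪 ⊗_R A`. [folklore] -/
theorem tmul_add_eq (c : 𝒪) (a b : A) :
    (CoeffExtension.tmul c (a + b) : CoeffExtension R 𝒪 A) = CoeffExtension.tmul c a + CoeffExtension.tmul c b := by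
  change (c ⊗ₜ[R] (a + b) : 𝒪 ⊗[R] A) = c ⊗ₜ[R] a + c ⊗ₜ[R] b
  rw [TensorProduct.tmul_add]

/-- `c ⊗ 0 = 0` in `𝒪 ⊗_R A`. [folklore] -/
theorem tmul_zero_eq (c : 𝒪) : (CoeffExtension.tmul c (0 : A) : CoeffExtension R 𝒪 A) = 0 := by
  change (c ⊗ₜ[R] (0 : A) : 𝒪 ⊗[R] A) = 0
  rw [TensorProduct.tmul_zero]

/-- If `c ⊗ a = 0` in `𝒪 ⊗_R A`, then `φ(c) • a = 0` for every `R`-linear form `φ` on `𝒪` (apply the linear map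
`𝒪 ⊗ A → A` induced by `(x, b) ↦ φ(x) • b`). [folklore] -/
theorem smul_eq_zero_of_tmul_eq_zero (φ : 𝒪 →ₗ[R] R) {c : 𝒪} {a : A}
    (h : (CoeffExtension.tmul c a : CoeffExtension R 𝒪 A) = 0) : φ c • a = 0 := by
  have e : TensorProduct.lift ((LinearMap.lsmul R A).comp φ) (c ⊗ₜ[R] a) = φ c • a := by
    rw [TensorProduct.lift.tmul]; rfl
  have h' : (c ⊗ₜ[R] a : 𝒪 ⊗[R] A) = 0 := h
  rw [← e, h', map_zero]

/-- **Coordinates**: for `𝒪` free over `ℤ_p`, if `c ⊗ a = 0` in `𝒪 ⊗_{ℤ_p} A` and every `r ∈ ℤ_p` killing `a` is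
divisible by `p`, then `c ∈ p𝒪` (each coordinate of `c` in a `ℤ_p`-basis kills `a`, hence lies in `pℤ_p`).
[cite: Skinner2016PacificMC, §2.3 (`𝒪` free of finite rank over `ℤ_p`)] -/
theorem exists_eq_mul_of_tmul_eq_zero {p : ℕ} [Fact p.Prime] [Algebra ℤ_[p] 𝒪] [Module.Free ℤ_[p] 𝒪]
    {B : Type*} [AddCommGroup B] [Module ℤ_[p] B] {c : 𝒪} {a : B}
    (ha : ∀ r : ℤ_[p], r • a = 0 → (p : ℤ_[p]) ∣ r)
    (h : (CoeffExtension.tmul c a : CoeffExtension ℤ_[p] 𝒪 B) = 0) :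
    ∃ d : 𝒪, c = (p : 𝒪) * d := by
  classical
  let b := Module.Free.chooseBasis ℤ_[p] 𝒪
  -- every coordinate of `c` is divisible by `p`
  have hcoord : ∀ j, (p : ℤ_[p]) ∣ b.repr c j := fun j ↦
    ha _ (by simpa using smul_eq_zero_of_tmul_eq_zero (b.coord j) h)
  choose q hq using hcoord
  refine ⟨(b.repr c).sum fun j _ ↦ q j • b j, ?_⟩
  have hc : c = (b.repr c).sum fun j x ↦ x • b j := by
    conv_lhs => rw [← b.linearCombination_repr c]
    rfl
  conv_lhs => rw [hc]
  simp only [Finsupp.sum, Finset.mul_sum]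
  refine Finset.sum_congr rfl fun j _ ↦ ?_
  rw [hq j, mul_smul, Algebra.smul_def, map_natCast]

end Tensor

/-! ## §2 `A[ϖ] → (𝒪/ϖ)ⁿ`, `x mod 𝒪ⁿ ↦ ϖx mod ϖ`, for a framed representation `ρ : G → GL_n(𝒪)` -/

section Reduction

variable {G : Type*} [Group G] [TopologicalSpace G] {n : ℕ} {𝒪 : Type*} [CommRing 𝒪] [TopologicalSpace 𝒪]
  {F : Type*} [Field F] [Algebra 𝒪 F]

/-- **`A[ϖ] ≅ T/ϖT` as `G`-modules, in map form.** For a framed representation `ρ : G → GL_n(𝒪)`, `𝒪 ⊆ F` (injective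
structure map) and `ϖ ∈ 𝒪 ∖ 0`, with `A = Fⁿ/𝒪ⁿ = Cofree ρ F`: there is an injective additive map
`Θ₀ : A[ϖ] → (𝒪/ϖ)ⁿ`, `x mod 𝒪ⁿ ↦ (ϖx) mod ϖ`, with `Θ₀(g · a) = ρ̄(g) Θ₀(a)` for the reduction `ρ̄ = ρ mod ϖ`
(`FramedRep.baseChangeRepresentation` along `𝒪 → 𝒪/ϖ`). [cite: EmertonPollackWeston2006, §3.1 (p. 17: `A_f = K/𝒪 ⊗ T_f`, `T̄_f = T_f/π T_f`)] -/
theorem exists_torsion_reduction_hom (ρ : FramedRep G 𝒪 n) {ϖ : 𝒪} (hϖ : ϖ ≠ 0)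
    (hinj : Function.Injective (algebraMap 𝒪 F)) :
    ∃ Θ₀ : Submodule.torsionBy 𝒪 (Cofree ρ F) ϖ →+ (Fin n → 𝒪 ⧸ Ideal.span {ϖ}),
      Function.Injective Θ₀ ∧
      ∀ (g : G) (a a' : Submodule.torsionBy 𝒪 (Cofree ρ F) ϖ), (a' : Cofree ρ F) = g • (a : Cofree ρ F) →
        Θ₀ a' = FramedRep.baseChangeRepresentation (Ideal.Quotient.mk (Ideal.span {ϖ})) ρ g (Θ₀ a) := by
  classical
  have hϖF : algebraMap 𝒪 F ϖ ≠ 0 := fun h ↦ hϖ (hinj (by rw [h, map_zero]))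
  -- lifts: `a = x mod 𝒪ⁿ` with `ϖ x = y ∈ 𝒪ⁿ`
  have hlift : ∀ a : Submodule.torsionBy 𝒪 (Cofree ρ F) ϖ, ∃ (x : Fin n → F) (yv : Fin n → 𝒪),
      cofreeMk F ρ x = (a : Cofree ρ F) ∧ (fun i ↦ algebraMap 𝒪 F (yv i)) = ϖ • x := by
    intro a
    obtain ⟨x, hx⟩ := cofreeMk_surjective F ρ (a : Cofree ρ F)
    have hmem : ϖ • x ∈ lattice n 𝒪 F := by
      rw [← ker_cofreeMk F ρ, LinearMap.mem_ker, map_smul, hx]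
      exact (Submodule.mem_torsionBy_iff _ _).1 a.2
    obtain ⟨yv, hyv⟩ := (mem_lattice_iff _).1 hmem
    exact ⟨x, yv, hx, hyv⟩
  choose x yv hx hyv using hlift
  -- well-definedness: the reduction of `y` does not depend on the lift
  have hwd : ∀ (a : Submodule.torsionBy 𝒪 (Cofree ρ F) ϖ) (x' : Fin n → F) (yv' : Fin n → 𝒪),
      cofreeMk F ρ x' = (a : Cofree ρ F) → (fun i ↦ algebraMap 𝒪 F (yv' i)) = ϖ • x' →
      (fun i ↦ Ideal.Quotient.mk (Ideal.span {ϖ}) (yv' i)) = fun i ↦ Ideal.Quotient.mk (Ideal.span {ϖ}) (yv a i) := by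
    intro a x' yv' hx' hyv'
    have hdiff : x' - x a ∈ lattice n 𝒪 F := by
      rw [← ker_cofreeMk F ρ, LinearMap.mem_ker, map_sub, hx', hx, sub_self]
    obtain ⟨l, hl⟩ := (mem_lattice_iff _).1 hdiff
    funext i
    apply (Ideal.Quotient.eq).2
    refine Ideal.mem_span_singleton'.2 ⟨l i, hinj ?_⟩
    have h1 : algebraMap 𝒪 F (yv' i) = ϖ • x' i := congrFun hyv' i
    have h2 : algebraMap 𝒪 F (yv a i) = ϖ • x a i := congrFun (hyv a) i
    have h3 : algebraMap 𝒪 F (l i) = x' i - x a i := congrFun hl i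
    rw [map_mul, mul_comm, ← Algebra.smul_def, h3, smul_sub, ← h1, ← h2, map_sub]
  -- the map
  let Θf : Submodule.torsionBy 𝒪 (Cofree ρ F) ϖ → (Fin n → 𝒪 ⧸ Ideal.span {ϖ}) :=
    fun a i ↦ Ideal.Quotient.mk (Ideal.span {ϖ}) (yv a i)
  have hadd : ∀ a a', Θf (a + a') = Θf a + Θf a' := by
    intro a a'
    have h := hwd (a + a') (x a + x a') (yv a + yv a')
      (by rw [map_add, hx, hx]; rfl)
      (by funext i
          have e1 : algebraMap 𝒪 F (yv a i) = ϖ • x a i := congrFun (hyv a) i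
          have e2 : algebraMap 𝒪 F (yv a' i) = ϖ • x a' i := congrFun (hyv a') i
          change algebraMap 𝒪 F (yv a i + yv a' i) = ϖ • (x a i + x a' i)
          rw [map_add, smul_add, e1, e2])
    change (fun i ↦ Ideal.Quotient.mk (Ideal.span {ϖ}) (yv (a + a') i)) = _
    rw [← h]
    funext i
    change Ideal.Quotient.mk (Ideal.span {ϖ}) (yv a i + yv a' i) =
      Ideal.Quotient.mk (Ideal.span {ϖ}) (yv a i) + Ideal.Quotient.mk (Ideal.span {ϖ}) (yv a' i)
    rw [map_add]
  refine ⟨AddMonoidHom.mk' Θf hadd, ?_, ?_⟩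
  · -- injectivity: `y ∈ ϖ𝒪ⁿ` forces `x ∈ 𝒪ⁿ`
    intro a a' haa'
    rw [← sub_eq_zero] at haa' ⊢
    rw [← map_sub] at haa'
    set d := a - a'
    have hzero : ∀ i, Ideal.Quotient.mk (Ideal.span {ϖ}) (yv d i) = 0 := fun i ↦ congrFun haa' i
    have hw : ∀ i, ∃ w : 𝒪, yv d i = ϖ * w := fun i ↦ by
      obtain ⟨w, hw⟩ := Ideal.mem_span_singleton'.1 (Ideal.Quotient.eq_zero_iff_mem.1 (hzero i))
      exact ⟨w, by rw [← hw, mul_comm]⟩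
    choose w hw using hw
    have hxd : x d ∈ lattice n 𝒪 F := by
      rw [mem_lattice_iff]
      refine ⟨w, funext fun i ↦ ?_⟩
      have h : algebraMap 𝒪 F (yv d i) = ϖ • x d i := congrFun (hyv d) i
      rw [Algebra.smul_def, hw i, map_mul] at h
      exact mul_left_cancel₀ hϖF h
    have hd : (d : Cofree ρ F) = 0 := by
      rw [← hx d, ← LinearMap.mem_ker, ker_cofreeMk]
      exact hxd
    exact Subtype.ext hd
  · -- equivariance
    intro g a a' ha'
    set Mg : Matrix (Fin n) (Fin n) 𝒪 := ((ρ g : GL (Fin n) 𝒪) : Matrix (Fin n) (Fin n) 𝒪)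
    have h := hwd a' (fracRepresentation F ρ g (x a)) (Mg.mulVec (yv a))
      (by rw [ha', ← hx a, smul_cofreeMk])
      (by
        funext i
        rw [RingHom.map_mulVec, Pi.smul_apply, fracRepresentation_apply_apply, ← Pi.smul_apply,
          ← Matrix.mulVec_smul]
        congr 1
        funext j
        exact congrFun (hyv a) j)
    change (fun i ↦ Ideal.Quotient.mk (Ideal.span {ϖ}) (yv a' i)) = _
    rw [← h]
    funext i
    rw [FramedRep.baseChangeRepresentation_apply_apply]
    exact RingHom.map_mulVec (Ideal.Quotient.mk (Ideal.span {ϖ})) Mg (yv a) i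

end Reduction

/-! ## §3 Transport along a torsion-level equivariant isomorphism; assembly -/

section Transport

/-- **Step 2 — transport through a torsion-level isomorphism (pure algebra).** Let `e : X[r] ≃ N[r]` be an `𝒪`-linear
isomorphism of `r`-torsion submodules compatible with operators `f_X(σ)`, `f_N(σ)` (`σ ∈ G`; for each `a ∈ X[r]` some
`a' ∈ X[r]` has `a' = f_X(σ) a` and `e a' = f_N(σ) (e a)`), and `β : E → N[r]` an injective additive map killed by `ϖ` with
`β(σ P) = f_N(σ) β(P)`. Then `α = e⁻¹ ∘ β : E → X[ϖ]` is injective, additive, and `α(σ P) = f_X(σ) α(P)`. (Used with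
`e = D.e`, the member's `A_{g_m}[p^m] ≃ (E[p^∞] ⊗ 𝒪_m)[p^m]` of §3.1 (b).) [cite: Skinner2016PacificMC, §3.1 (b) (p. 192) ("as `𝒪[G_ℚ]`-modules")] -/
theorem exists_transport_torsion_hom {𝒪 X N E G : Type*} [CommRing 𝒪] [AddCommGroup X] [Module 𝒪 X]
    [AddCommGroup N] [Module 𝒪 N] [AddCommGroup E] [SMul G E] {r ϖ : 𝒪} (fX : G → X → X) (fN : G → N → N)
    (e : Submodule.torsionBy 𝒪 X r ≃ₗ[𝒪] Submodule.torsionBy 𝒪 N r)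
    (he : ∀ (σ : G) (a : Submodule.torsionBy 𝒪 X r), ∃ a' : Submodule.torsionBy 𝒪 X r,
      (a' : X) = fX σ (a : X) ∧ (e a' : N) = fN σ (e a : N))
    (β : E →+ Submodule.torsionBy 𝒪 N r) (hβ : Function.Injective β) (hβϖ : ∀ P, ϖ • (β P : N) = 0)
    (hβσ : ∀ (σ : G) (P : E), (β (σ • P) : N) = fN σ (β P : N)) :
    ∃ α : E →+ Submodule.torsionBy 𝒪 X ϖ, Function.Injective α ∧
      ∀ (σ : G) (P : E), (α (σ • P) : X) = fX σ (α P : X) := by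
  classical
  have he0 : e.symm 0 = 0 := map_zero e.symm
  -- `a P = e⁻¹ (β P)`, killed by `ϖ`
  have hamem : ∀ P, ((e.symm (β P) : Submodule.torsionBy 𝒪 X r) : X) ∈ Submodule.torsionBy 𝒪 X ϖ := fun P ↦ by
    have h0 : ϖ • β P = 0 := Subtype.ext (by rw [Submodule.coe_smul, hβϖ, Submodule.coe_zero])
    have h1 : e.symm (ϖ • β P) = ϖ • e.symm (β P) := map_smul e.symm ϖ (β P)
    rw [Submodule.mem_torsionBy_iff, ← Submodule.coe_smul, ← h1, h0, he0, Submodule.coe_zero]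
  let a : E → Submodule.torsionBy 𝒪 X ϖ := fun P ↦ ⟨((e.symm (β P) : Submodule.torsionBy 𝒪 X r) : X), hamem P⟩
  have haadd : ∀ P Q, a (P + Q) = a P + a Q := fun P Q ↦ Subtype.ext (by
    change ((e.symm (β (P + Q)) : Submodule.torsionBy 𝒪 X r) : X) =
      ((e.symm (β P) : Submodule.torsionBy 𝒪 X r) : X) + ((e.symm (β Q) : Submodule.torsionBy 𝒪 X r) : X)
    rw [map_add β P Q, map_add e.symm (β P) (β Q), Submodule.coe_add])
  refine ⟨AddMonoidHom.mk' a haadd, ?_, fun σ P ↦ ?_⟩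
  · -- injectivity
    refine (injective_iff_map_eq_zero _).2 fun P hP ↦ ?_
    have hval : ((e.symm (β P) : Submodule.torsionBy 𝒪 X r) : X) = 0 := by
      have h := congrArg Subtype.val hP
      exact h
    have heP : e.symm (β P) = 0 := Subtype.ext hval
    have hbP : β P = 0 := e.symm.injective (heP.trans he0.symm)
    exact (injective_iff_map_eq_zero β).1 hβ P hbP
  · -- equivariance: `e a' = f_N(σ) (β P) = β (σ P)`, so `a' = e⁻¹ β (σ P)`
    obtain ⟨a', ha', hea'⟩ := he σ (e.symm (β P))
    rw [LinearEquiv.apply_symm_apply, ← hβσ] at hea'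
    have h2 : a' = e.symm (β (σ • P)) := by
      rw [← LinearEquiv.symm_apply_apply e a']
      exact congrArg e.symm (Subtype.ext hea')
    change ((e.symm (β (σ • P)) : Submodule.torsionBy 𝒪 X r) : X) = fX σ ((e.symm (β P) : Submodule.torsionBy 𝒪 X r) : X)
    rw [← h2, ha']

/-- **Step 3 — assembly (pure algebra).** With the data of step 2 and an injective additive `Θ₀ : X[ϖ] → V` intertwining
`f_X(σ)` with operators `f_V(σ)` on `V`, the composite `Θ₀ ∘ e⁻¹ ∘ β : E → V` is injective, additive and satisfies
`Θ(σ P) = f_V(σ) Θ(P)`. (All inputs in `∃`-form, so that the arithmetic instance below is a single application.) [folklore] -/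
theorem exists_equivariant_hom_of_transport {𝒪 X N V E G : Type*} [CommRing 𝒪] [AddCommGroup X] [Module 𝒪 X]
    [AddCommGroup N] [Module 𝒪 N] [AddCommGroup V] [AddCommGroup E] [SMul G E] {r ϖ : 𝒪}
    (fX : G → X → X) (fN : G → N → N) (fV : G → V → V)
    (hΘ₀ : ∃ Θ₀ : Submodule.torsionBy 𝒪 X ϖ →+ V, Function.Injective Θ₀ ∧
      ∀ (g : G) (a a' : Submodule.torsionBy 𝒪 X ϖ), (a' : X) = fX g (a : X) → Θ₀ a' = fV g (Θ₀ a))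
    (e : Submodule.torsionBy 𝒪 X r ≃ₗ[𝒪] Submodule.torsionBy 𝒪 N r)
    (he : ∀ (σ : G) (a : Submodule.torsionBy 𝒪 X r), ∃ a' : Submodule.torsionBy 𝒪 X r,
      (a' : X) = fX σ (a : X) ∧ (e a' : N) = fN σ (e a : N))
    (hβ : ∃ β : E →+ Submodule.torsionBy 𝒪 N r, Function.Injective β ∧ (∀ P, ϖ • (β P : N) = 0) ∧
      ∀ (σ : G) (P : E), (β (σ • P) : N) = fN σ (β P : N)) :
    ∃ Θ : E →+ V, Function.Injective Θ ∧ ∀ (σ : G) (P : E), Θ (σ • P) = fV σ (Θ P) := by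
  obtain ⟨Θ₀, hΘ₀i, hΘ₀eq⟩ := hΘ₀
  obtain ⟨β, hβi, hβϖ, hβσ⟩ := hβ
  obtain ⟨α, hα, hασ⟩ := exists_transport_torsion_hom fX fN e he β hβi hβϖ hβσ
  exact ⟨Θ₀.comp α, hΘ₀i.comp hα, fun σ P ↦ hΘ₀eq σ (α P) (α (σ • P)) (hασ σ P)⟩

end Transport

end Summit.BirchSwinnertonDyer.BirchSwinnertonDyer.Theorems.SurjIrrK

end
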